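import Summits.NavierStokesRegularity.FluidComputer.PalasekTowerGermHostFlatPusher
import Literature.Analysis.FluidPDE.BiotSavartCurlPair
import Literature.Analysis.FluidPDE.VectorCalculusProofs
import Literature.Analysis.FluidPDE.TaoAveragedNondegeneracy

/-!
# The germ host, XI: HORIZONTAL PUSHERS `curl(ψ e)` — divergence free, compactly supported, orthogonal to `e`

Cell `ns-blowup`, seat `ns-blowup-ecbridge-3` (g3); GROUP C «BRIDGE SUPPORT» of the route
`PalasekTowerBreakdown` (crux `EpisodeBaseG`, item stmt-NavierStokesRegularity-19179, R2 of record).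
LABEL: E–C typing (KERNEL: one definition with body + its calculus). WHAT THIS IS NOT: not
Navier–Stokes evidence — a family of PRESCRIBED test fields; no profile passing the anchor test is
built here (the scalar `ψ` is left free).

## What and why

The abstract instance theorem `inner_accel_pos_of_flat_forward` (p450880) wants a pusher `U₂ ∈ C_c^∞`,
divergence free, with velocities ORTHOGONAL to the carrier's value `e = U₁(x₀)`. This file supplies
the whole family at once: for any scalar `ψ ∈ C_c^∞(ℝ³)` and any vector `e`,

  `horizField e ψ := curl (ψ • e) = ∇ψ × e`

is smooth, divergence free (`div curl = 0`), supported in `tsupport ψ`, orthogonal to `e` pointwise,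
and bounded by `‖∇ψ‖ ‖e‖` (§1); and (§2) **`inner_accel_pos_of_flat_horizontal`** — the abstract
instance theorem with `U₂ := horizField (U₁ x₀) ψ`: a flat even carrier plus ANY non-trivial such
pusher supported in the closed forward cone (strictly somewhere) at positive distance from `x₀`, with
support disjoint from the carrier's, passes the strict anchor test at every viscosity. What a kernel
instance of `LevelZeroData` still owes: the explicit flat carrier, and the readouts (speed `< Y₀`,
strain `A₀`, `N₀`-core loop) of one explicit `ψ`.

References: A. J. Majda, A. L. Bertozzi, *Vorticity and Incompressible Flow* (CUP 2002), §1.1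
(vector identities `curl(gV₀) = ∇g × V₀`, `div curl = 0`) [cite: MajdaBertozziCUP2002, §1.1 (vector identities)].
-/

noncomputable section

namespace Summit.NavierStokesRegularity.FluidComputer.PalasekTowerClayBridge.Germ

open Set Function Filter Topology InnerProductSpace MeasureTheory Real
open scoped Topology ContDiff RealInnerProductSpace Laplacian

open Literature.Analysis.FluidPDE

/-! ## §1 The horizontal field of a scalar -/

/-- **The horizontal field** `horizField e ψ = curl (ψ • e)` (`= ∇ψ × e`; for `e = e₃`:
`(∂₂ψ, −∂₁ψ, 0)`). [cite: MajdaBertozziCUP2002, §1.1 (vector identities)] -/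
def horizField (e : EuclideanSpace ℝ (Fin 3)) (ψ : EuclideanSpace ℝ (Fin 3) → ℝ) :
    EuclideanSpace ℝ (Fin 3) → EuclideanSpace ℝ (Fin 3) :=
  curl fun y => ψ y • e

section Horizontal

variable {e : EuclideanSpace ℝ (Fin 3)} {ψ : EuclideanSpace ℝ (Fin 3) → ℝ}

/-- `horizField e ψ x = ∇ψ(x) × e` at points of differentiability. [cite: MajdaBertozziCUP2002, §1.1 (vector identities)] -/
theorem horizField_apply {x : EuclideanSpace ℝ (Fin 3)} (hψ : DifferentiableAt ℝ ψ x) :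
    horizField e ψ x = cross (gradient ψ x) e :=
  curl_smul_const hψ e

/-- The horizontal field of a smooth scalar is smooth. [folklore] -/
theorem contDiff_horizField (hψ : ContDiff ℝ ∞ ψ) : ContDiff ℝ ∞ (horizField e ψ) := by
  have h' : ContDiff ℝ ∞ (fun y => ψ y • e) := hψ.smul contDiff_const
  have h : ContDiff ℝ ((⊤ : ℕ∞) + 1 : ℕ∞) (fun y => ψ y • e) := by simpa using h'
  exact contDiff_curl h

/-- The horizontal field is compactly supported when `ψ` is. [folklore] -/
theorem hasCompactSupport_horizField (hψc : HasCompactSupport ψ) : HasCompactSupport (horizField e ψ) :=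
  hasCompactSupport_curl (hψc.smul_right (f' := fun _ => e))

/-- The horizontal field vanishes off `tsupport ψ`. [folklore] -/
theorem horizField_eq_zero_of_notMem {x : EuclideanSpace ℝ (Fin 3)} (hx : x ∉ tsupport ψ) :
    horizField e ψ x = 0 := by
  refine curl_eq_zero_of_notMem_tsupport fun h => hx ?_
  exact (tsupport_smul_subset_left (fun y => ψ y) fun _ => e) h

/-- `tsupport (horizField e ψ) ⊆ tsupport ψ`. [folklore] -/
theorem tsupport_horizField_subset : tsupport (horizField e ψ) ⊆ tsupport ψ := by
  refine closure_minimal (fun x hx => ?_) (isClosed_tsupport ψ)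
  by_contra h
  exact hx (horizField_eq_zero_of_notMem h)

/-- **Divergence free** (`div curl = 0`). [cite: MajdaBertozziCUP2002, §1.1 (vector identities)] -/
theorem isDivFree_horizField (hψ : ContDiff ℝ ∞ ψ) : VectorCalculus.IsDivFree (horizField e ψ) :=
  fun x => divergence_curl_eq_zero_holds _ ((hψ.smul contDiff_const).of_le (by norm_cast)) x

/-- **Orthogonal to `e`** pointwise. [folklore] -/
theorem inner_horizField (hψ : Differentiable ℝ ψ) (x : EuclideanSpace ℝ (Fin 3)) :
    ⟪horizField e ψ x, e⟫ = 0 := by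
  rw [horizField_apply (hψ x)]
  exact Tao2016.inner_cross_self_right _ _

/-- `‖horizField e ψ x‖ ≤ ‖∇ψ(x)‖ ‖e‖`. [folklore] -/
theorem norm_horizField_le (hψ : Differentiable ℝ ψ) (x : EuclideanSpace ℝ (Fin 3)) :
    ‖horizField e ψ x‖ ≤ ‖gradient ψ x‖ * ‖e‖ := by
  rw [horizField_apply (hψ x), norm_cross]
  exact mul_le_of_le_one_right (by positivity) (Real.sin_le_one _)

end Horizontal

/-! ## §2 The abstract instance theorem for horizontal pushers -/

/-- **A FLAT SYMMETRIC CARRIER WITH A FORWARD-CONE HORIZONTAL PUSHER PASSES THE STRICT ANCHOR TEST.**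
`U₁ ∈ C_c^∞` divergence free, even about `x₀`, flat there (`ΔU₁(x₀) = 0`); `ψ ∈ C_c^∞` with
`tsupport ψ` disjoint from `tsupport U₁`, at distance `> r > 0` from `x₀`, inside the closed forward
cone of `e = U₁(x₀)` (`⟪x₀ − x, e⟫ ≤ 0` and `5⟨x₀ − x, d⟩² ≤ ‖x₀ − x‖²‖d‖²` for `d = horizField e ψ x`
on `tsupport ψ`), and some point where the pusher is non-zero strictly inside the cone. Then
`⟪U(x₀), V(x₀)⟫ > 0` for `U = U₁ + horizField e ψ` at every viscosity. [cite: MajdaBertozziCUP2002, §1.8 Prop. 1.16] -/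
theorem inner_accel_pos_of_flat_horizontal {ν : ℝ}
    {U₁ : EuclideanSpace ℝ (Fin 3) → EuclideanSpace ℝ (Fin 3)} {ψ : EuclideanSpace ℝ (Fin 3) → ℝ}
    {x₀ : EuclideanSpace ℝ (Fin 3)}
    (h₁ : ContDiff ℝ ∞ U₁) (h₁c : HasCompactSupport U₁) (hdiv₁ : VectorCalculus.IsDivFree U₁)
    (he : IsEvenAbout x₀ U₁) (hflat : (Δ U₁) x₀ = 0)
    (hψ : ContDiff ℝ ∞ ψ) (hψc : HasCompactSupport ψ)
    (hd : Disjoint (tsupport U₁) (tsupport ψ)) {r : ℝ} (hr : 0 < r)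
    (hfar : ∀ x ∈ tsupport ψ, r < ‖x₀ - x‖)
    (hfwd : ∀ x ∈ tsupport ψ, ⟪x₀ - x, U₁ x₀⟫ ≤ 0)
    (hcone : ∀ x ∈ tsupport ψ,
      5 * ⟪x₀ - x, horizField (U₁ x₀) ψ x⟫ ^ 2 ≤ ‖x₀ - x‖ ^ 2 * ‖horizField (U₁ x₀) ψ x‖ ^ 2)
    {x₁ : EuclideanSpace ℝ (Fin 3)} (hfwd₁ : ⟪x₀ - x₁, U₁ x₀⟫ < 0)
    (hcone₁ : 5 * ⟪x₀ - x₁, horizField (U₁ x₀) ψ x₁⟫ ^ 2 <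
      ‖x₀ - x₁‖ ^ 2 * ‖horizField (U₁ x₀) ψ x₁‖ ^ 2) :
    0 < ⟪(U₁ + horizField (U₁ x₀) ψ) x₀, accel ν (U₁ + horizField (U₁ x₀) ψ) x₀⟫ := by
  have hsub : tsupport (horizField (U₁ x₀) ψ) ⊆ tsupport ψ := tsupport_horizField_subset
  refine inner_accel_pos_of_flat_forward h₁ h₁c hdiv₁ he hflat (contDiff_horizField hψ)
    (hasCompactSupport_horizField hψc) (isDivFree_horizField hψ) (hd.mono_right hsub) hr
    (fun x hx => hfar x (hsub hx)) (inner_horizField (hψ.differentiable (by simp)))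
    (fun x hx => hfwd x (hsub hx)) (fun x hx => hcone x (hsub hx)) hfwd₁ hcone₁

end Summit.NavierStokesRegularity.FluidComputer.PalasekTowerClayBridge.Germ

end
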